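import Literature.NumberTheory.LFunctions.YoshidaWindowGramFrontDoorW
import HarnessLib

/-!
# Kernel enclosures of Yoshida's matrix coefficients — X: the far diagonals with a CERTIFIED prime constant `A`

Source: H. Yoshida, Adv. Stud. Pure Math. **21** (1992) 281–325, §§5–7 [Yoshida1992HermitianForms] (the hermitian form
and its matrix coefficients); R. E. Moore, *Interval Analysis* (1966), Ch. 3 [Moore1966] (inclusion property).

Parts V-b / VI (`YoshidaWindowGramFrontDoor.lean`, `YoshidaWindowGramFrontDoorW.lean`) enclose the far diagonals
`d̂⁺(m)`, `d̂⁻ − π/4`, `d̂⁻_atan(l)` of the format-C front door with the PRIME part bounded by the path-graph constant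
`A_op⁺(a) = Σ_{k∈weilPrimeIndex a} Λ(k)k^{−1/2}·2cos(π/(⌊2a/log k⌋₊+2))` (`Encl.primeOp`), entering the boxes
`devEvenBox` / `devOddBox` / `devOddABox` ONLY through the record field `F.Aop` (`FDValid.Aop : primeOp a ∈ F.Aop`).
A front door whose far diagonals carry `A/2` for an ARBITRARY certified prime constant `A` (any `A` with
`−A·Σ|c_n|² ≤ Σ Re(c̄_n c_m)·primeCoeff a n m`) needs the same boxes read at a record whose `Aop` field encloses `A`:

* `Encl.FDValidA S a A F` — validity of the front-door constants with `A ∈ F.Aop` (`FDValid` is the case `A = A_op⁺(a)`: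
  `FDValid.toA`, `FDValidA.toFD`); `FDValid.withAop` / `FDValidA.withAop` — replace the `Aop` field by any box of `A`
  (e.g. `MI.ofFrac S p q` for a rational `A = p/q`, `FDValid.withFrac`);
* `Encl.devEvenA`, `Encl.devOdd0A`, `Encl.devOddAA` — the three far diagonals with `A / 2` in place of `A_op⁺/2`, verbatim;
* `Encl.devEvenBox_lo_le_A`, `Encl.devOddBox_lo_le_A`, `Encl.devOddABox_lo_le_A`, `Encl.weights_of_checkOdd_A` — the
  soundness lemmas of parts V-b / VI under `FDValidA` (same boxes, same kernel checks; proofs transcribed with `hF.Aop`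
  now reading `A`); the identities `devEvenA_eq` & co. (`d̂_A = d̂ + (A_op⁺ − A)/2`).

No new computable functions: every `decide +kernel` certificate of a rung is textually unchanged, only the record it
evaluates differs.  Everything is proved; no named facts.
-/

open Real Complex Finset Matrix
open scoped BigOperators

namespace Literature.NumberTheory.LFunctions.Yoshida1992

open Literature.Analysis.SpecialFunctions Literature.Analysis.ValidatedNumerics.NumericsMP
open Literature.Analysis.ValidatedNumerics
open scoped ArithmeticFunction.vonMangoldt

namespace Encl

variable {S : ℕ} {a A : ℝ} {ks : List PrimeLen} {C : Consts} {ctab : List IdxRec}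

/-! ## Validity of the front-door constants with a certified prime constant -/

/-- Validity of the front-door constants record `F` at scale `S` for the window `a`, with the `Aop` field enclosing an
ARBITRARY real `A` (the certified prime constant of the door) instead of `A_op⁺(a)`.
[cite: Moore1966, Ch. 3 (interval arithmetic: inclusion property)] -/
structure FDValidA (S : ℕ) (a A : ℝ) (F : FDConsts) : Prop where
  /-- `weilArchDensity (2a) ∈ E2` -/
  E2 : MI.mem S (weilArchDensity (2 * a)) F.E2
  /-- `a(1+weilArchDensity(2a)) ∈ Ca` -/
  Ca : MI.mem S (a * (1 + weilArchDensity (2 * a))) F.Ca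
  /-- `primeMass a ∈ A1` -/
  A1 : MI.mem S (primeMass a) F.A1
  /-- `A ∈ Aop` -/
  Aop : MI.mem S A F.Aop
  /-- `(e^{a/2} − e^{−a/2})² ∈ s2` -/
  s2 : MI.mem S ((Real.exp (a / 2) - Real.exp (-(a / 2))) ^ 2) F.s2
  /-- `1/π² ∈ invPi2` -/
  invPi2 : MI.mem S (1 / π ^ 2) F.invPi2

/-- `FDValid` is `FDValidA` at `A = A_op⁺(a)`. [cite: Moore1966, Ch. 3 (interval arithmetic: inclusion property)] -/
theorem FDValid.toA {F : FDConsts} (hF : FDValid S a F) : FDValidA S a (primeOp a) F :=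
  ⟨hF.E2, hF.Ca, hF.A1, hF.Aop, hF.s2, hF.invPi2⟩

/-- Conversely. [cite: Moore1966, Ch. 3 (interval arithmetic: inclusion property)] -/
theorem FDValidA.toFD {F : FDConsts} (hF : FDValidA S a (primeOp a) F) : FDValid S a F :=
  ⟨hF.E2, hF.Ca, hF.A1, hF.Aop, hF.s2, hF.invPi2⟩

/-- Replace the `Aop` field of a valid record by any box of `A`. [cite: Moore1966, Ch. 3 (interval arithmetic: inclusion property)] -/
theorem FDValidA.withAop {A' : ℝ} {F : FDConsts} (hF : FDValidA S a A' F) {FA : MI} (hA : MI.mem S A FA) :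
    FDValidA S a A { F with Aop := FA } :=
  ⟨hF.E2, hF.Ca, hF.A1, hA, hF.s2, hF.invPi2⟩

/-- Replace the `Aop` field of a valid record by any box of `A`. [cite: Moore1966, Ch. 3 (interval arithmetic: inclusion property)] -/
theorem FDValid.withAop {F : FDConsts} (hF : FDValid S a F) {FA : MI} (hA : MI.mem S A FA) :
    FDValidA S a A { F with Aop := FA } :=
  hF.toA.withAop hA

/-- The rational case: `Aop := MI.ofFrac S p q` encloses `A = p/q`. [cite: Moore1966, Ch. 3 (interval arithmetic: inclusion property)] -/
theorem FDValid.withFrac {F : FDConsts} (hF : FDValid S a F) (p : ℤ) {q : ℕ} (hq : 0 < q) :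
    FDValidA S a ((p : ℝ) / q) { F with Aop := MI.ofFrac S p q } :=
  hF.withAop (MI.mem_ofFrac S p hq)

/-! ## The far diagonals with `A / 2` in place of `A_op⁺/2` (verbatim RHS of the parametrised front door) -/

/-- The EVEN far diagonal `d̂⁺_A(m)` (block `Be`) with the prime part `A/2`. [cite: Yoshida1992HermitianForms, §7 pp. 305–312] -/
noncomputable def devEvenA (a A : ℝ) (Be m : ℕ) : ℝ :=
  (reDigammaQuarter (freq a m) - Real.log π) / 2 - a * (1 + weilArchDensity (2 * a)) / (π ^ 2 * m ^ 2) - 1 / (8 * m)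
    - a * (1 + weilArchDensity (2 * a)) / π ^ 2 * Real.sqrt (8 / ((Be - 1 : ℕ) : ℝ)) - A / 2

/-- The ODD far-diagonal CORE minus `π/4` (block `Bo`) with the prime part `A/2`. [cite: Yoshida1992HermitianForms, §7 pp. 305–312] -/
noncomputable def devOdd0A (a A : ℝ) (Bo l : ℕ) : ℝ :=
  (reDigammaQuarter (freq a ((l : ℤ) + 1)) - Real.log π) / 2 - 1 / (8 * ((l : ℝ) + 1))
    - a * (1 + weilArchDensity (2 * a)) / (π ^ 2 * ((l : ℝ) + 1) ^ 2) - π / 4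
    - a * (1 + weilArchDensity (2 * a)) / π ^ 2 * Real.sqrt (8 / Bo) - A / 2
    - (Real.exp (a / 2) - Real.exp (-(a / 2))) ^ 2 * a / (π ^ 2 * Bo)

/-- The ODD arctan far diagonal `d̂⁻_atan,A(l)` (block `Bo`) with the prime part `A/2`. [cite: Yoshida1992HermitianForms, §7 pp. 305–312] -/
noncomputable def devOddAA (a A : ℝ) (Bo l : ℕ) : ℝ :=
  (reDigammaQuarter (freq a ((l : ℤ) + 1)) - Real.log π) / 2 - 1 / (8 * ((l : ℝ) + 1))
    - a * (1 + weilArchDensity (2 * a)) / (π ^ 2 * ((l : ℝ) + 1) ^ 2)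
    - (π / 2 - Real.arctan (Real.sqrt Bo / Real.sqrt ((l : ℝ) + 1))) / 2
    - a * (1 + weilArchDensity (2 * a)) / π ^ 2 * Real.sqrt (8 / Bo) - A / 2
    - (Real.exp (a / 2) - Real.exp (-(a / 2))) ^ 2 * a / (π ^ 2 * Bo)

/-- `d̂⁺_A = d̂⁺ + A_op⁺/2 − A/2`. [cite: Yoshida1992HermitianForms, §7 pp. 305–312] -/
theorem devEvenA_eq (a A : ℝ) (Be m : ℕ) : devEvenA a A Be m = devEven a Be m + primeOp a / 2 - A / 2 := by
  unfold devEvenA devEven primeOp; ring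

/-- `core⁻_A − π/4 = (core⁻ − π/4) + A_op⁺/2 − A/2`. [cite: Yoshida1992HermitianForms, §7 pp. 305–312] -/
theorem devOdd0A_eq (a A : ℝ) (Bo l : ℕ) : devOdd0A a A Bo l = devOdd0 a Bo l + primeOp a / 2 - A / 2 := by
  unfold devOdd0A devOdd0 primeOp; ring

/-- `d̂⁻_atan,A = d̂⁻_atan + A_op⁺/2 − A/2`. [cite: Yoshida1992HermitianForms, §7 pp. 305–312] -/
theorem devOddAA_eq (a A : ℝ) (Bo l : ℕ) : devOddAA a A Bo l = devOddA a Bo l + primeOp a / 2 - A / 2 := by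
  unfold devOddAA devOddA primeOp; ring

/-! ## Soundness of the boxes under `FDValidA` -/

/-- **Lower bound of the even far diagonal (prime part `A/2`)**: `(devEvenBox …).lo ≤ d̂⁺_A(m)·S` (the proof of part
V-b verbatim: it only uses the MEMBERSHIP `A ∈ F.Aop`, never the value `A_op⁺(a)`). [cite: Yoshida1992HermitianForms, §7 pp. 305–312] -/
theorem devEvenBox_lo_le_A (hS : 0 < S) (ha0 : 0 < a) (hC : ConstsValid S a ks C) {F : FDConsts}
    (hF : FDValidA S a A F) {R : IdxRec} {m : ℕ} (hR : MI.mem S (reDigammaQuarter (freq a m)) R.reP) (hm : 0 < m)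
    {Be p q : ℕ} (hsq : checkSqrtUpper 8 (Be - 1) p q = true) :
    ((devEvenBox S C F R m p q).lo : ℝ) ≤ devEvenA a A Be m * S := by
  have hq : 0 < q := by
    simp only [checkSqrtUpper, Bool.and_eq_true, decide_eq_true_eq] at hsq; exact hsq.1.1
  set Ca := a * (1 + weilArchDensity (2 * a)) with hCa
  have hCa0 : 0 ≤ Ca := by
    have := weilArchDensity_pos (show 0 < 2 * a by positivity); rw [hCa]; positivity
  have hY : MI.mem S ((reDigammaQuarter (freq a m) - Real.log π) / 2 - Ca * (1 / π ^ 2) / (m * m : ℕ)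
      - 1 / (8 * m : ℕ) - Ca * (1 / π ^ 2) * ((p : ℝ) / q) - A / 2) (devEvenBox S C F R m p q) := by
    unfold devEvenBox
    refine MI.mem_sub (MI.mem_sub (MI.mem_sub (MI.mem_sub ?_ ?_) ?_) ?_) ?_
    · exact mem_of_eq (MI.mem_divNat (MI.mem_sub hR hC.logPi) (n := 2) (by norm_num)) (by norm_num)
    · exact MI.mem_divNat (MI.mem_mul hS hF.Ca hF.invPi2) (by positivity)
    · exact mem_of_eq (MI.mem_ofFrac S 1 (q := 8 * m) (by omega)) (by push_cast; ring)
    · exact mem_of_eq (MI.mem_mul hS (MI.mem_mul hS hF.Ca hF.invPi2) (MI.mem_ofFrac S p hq)) (by push_cast; ring)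
    · exact mem_of_eq (MI.mem_divNat hF.Aop (n := 2) (by norm_num)) (by norm_num)
  have hle : (reDigammaQuarter (freq a m) - Real.log π) / 2 - Ca * (1 / π ^ 2) / (m * m : ℕ)
      - 1 / (8 * m : ℕ) - Ca * (1 / π ^ 2) * ((p : ℝ) / q) - A / 2 ≤ devEvenA a A Be m := by
    unfold devEvenA
    have hs := sqrt_le_of_check hsq
    push_cast at hs ⊢
    have h1 : Ca * (1 / π ^ 2) * Real.sqrt (8 / ((Be - 1 : ℕ) : ℝ)) ≤ Ca * (1 / π ^ 2) * ((p : ℝ) / q) :=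
      mul_le_mul_of_nonneg_left (by exact_mod_cast hs) (by positivity)
    have e1 : Ca * (1 / π ^ 2) / ((m : ℝ) * m) = a * (1 + weilArchDensity (2 * a)) / (π ^ 2 * m ^ 2) := by
      rw [hCa]; field_simp
    have e2 : Ca * (1 / π ^ 2) * Real.sqrt (8 / ((Be - 1 : ℕ) : ℝ))
        = a * (1 + weilArchDensity (2 * a)) / π ^ 2 * Real.sqrt (8 / ((Be - 1 : ℕ) : ℝ)) := by rw [hCa]; ring
    rw [e1] ; linarith [h1, e2]
  have hSr : (0 : ℝ) < S := by exact_mod_cast hS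
  exact hY.1.trans (by nlinarith)

/-- **Lower bound of the odd far diagonal (core − π/4, prime part `A/2`)**: `(devOddBox …).lo ≤ devOdd0A·S` (record at
mode `l + 1`). [cite: Yoshida1992HermitianForms, §7 pp. 305–312] -/
theorem devOddBox_lo_le_A (hS : 0 < S) (ha0 : 0 < a) (hC : ConstsValid S a ks C) {F : FDConsts}
    (hF : FDValidA S a A F) {R : IdxRec} {l : ℕ} (hR : MI.mem S (reDigammaQuarter (freq a ((l : ℤ) + 1))) R.reP)
    {Bo p q : ℕ} (hBo : 0 < Bo) (hsq : checkSqrtUpper 8 Bo p q = true) :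
    ((devOddBox S C F R l Bo p q).lo : ℝ) ≤ devOdd0A a A Bo l * S := by
  have hq : 0 < q := by
    simp only [checkSqrtUpper, Bool.and_eq_true, decide_eq_true_eq] at hsq; exact hsq.1.1
  set Ca := a * (1 + weilArchDensity (2 * a)) with hCa
  have hCa0 : 0 ≤ Ca := by
    have := weilArchDensity_pos (show 0 < 2 * a by positivity); rw [hCa]; positivity
  set s2 := (Real.exp (a / 2) - Real.exp (-(a / 2))) ^ 2 with hs2
  have hY : MI.mem S ((reDigammaQuarter (freq a ((l : ℤ) + 1)) - Real.log π) / 2 - 1 / (8 * (l + 1) : ℕ)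
      - Ca * (1 / π ^ 2) / ((l + 1) * (l + 1) : ℕ) - π / 4 - Ca * (1 / π ^ 2) * ((p : ℝ) / q) - A / 2
      - s2 * a * (1 / π ^ 2) / Bo) (devOddBox S C F R l Bo p q) := by
    unfold devOddBox
    refine MI.mem_sub (MI.mem_sub (MI.mem_sub (MI.mem_sub (MI.mem_sub (MI.mem_sub ?_ ?_) ?_) ?_) ?_) ?_) ?_
    · exact mem_of_eq (MI.mem_divNat (MI.mem_sub hR hC.logPi) (n := 2) (by norm_num)) (by norm_num)
    · exact mem_of_eq (MI.mem_ofFrac S 1 (q := 8 * (l + 1)) (by omega)) (by push_cast; ring)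
    · exact MI.mem_divNat (MI.mem_mul hS hF.Ca hF.invPi2) (by positivity)
    · exact mem_of_eq (MI.mem_divNat hC.pi (n := 4) (by norm_num)) (by norm_num)
    · exact mem_of_eq (MI.mem_mul hS (MI.mem_mul hS hF.Ca hF.invPi2) (MI.mem_ofFrac S p hq)) (by push_cast; ring)
    · exact mem_of_eq (MI.mem_divNat hF.Aop (n := 2) (by norm_num)) (by norm_num)
    · exact mem_of_eq (MI.mem_divNat (MI.mem_mul hS (MI.mem_mul hS hF.s2 hC.ha) hF.invPi2) hBo) (by ring)
  have hle : (reDigammaQuarter (freq a ((l : ℤ) + 1)) - Real.log π) / 2 - 1 / (8 * (l + 1) : ℕ)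
      - Ca * (1 / π ^ 2) / ((l + 1) * (l + 1) : ℕ) - π / 4 - Ca * (1 / π ^ 2) * ((p : ℝ) / q) - A / 2
      - s2 * a * (1 / π ^ 2) / Bo ≤ devOdd0A a A Bo l := by
    unfold devOdd0A
    have hs := sqrt_le_of_check hsq
    have h1 : Ca * (1 / π ^ 2) * Real.sqrt (8 / (Bo : ℝ)) ≤ Ca * (1 / π ^ 2) * ((p : ℝ) / q) :=
      mul_le_mul_of_nonneg_left (by exact_mod_cast hs) (by positivity)
    have hl0 : (0 : ℝ) < (l : ℝ) + 1 := by positivity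
    have e1 : Ca * (1 / π ^ 2) / (((l + 1) * (l + 1) : ℕ) : ℝ) = a * (1 + weilArchDensity (2 * a)) / (π ^ 2 * ((l : ℝ) + 1) ^ 2) := by
      rw [hCa]; push_cast; field_simp
    have e2 : (1 : ℝ) / ((8 * (l + 1) : ℕ) : ℝ) = 1 / (8 * ((l : ℝ) + 1)) := by push_cast; ring
    have e3 : Ca * (1 / π ^ 2) * Real.sqrt (8 / (Bo : ℝ)) = a * (1 + weilArchDensity (2 * a)) / π ^ 2 * Real.sqrt (8 / Bo) := by
      rw [hCa]; ring
    have e4 : s2 * a * (1 / π ^ 2) / Bo = (Real.exp (a / 2) - Real.exp (-(a / 2))) ^ 2 * a / (π ^ 2 * Bo) := by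
      rw [hs2]; field_simp
    rw [e1, e2, e4]; linarith [h1, e3]
  have hSr : (0 : ℝ) < S := by exact_mod_cast hS
  exact hY.1.trans (by nlinarith)

/-- **Lower bound of the arctan far diagonal (prime part `A/2`)**: `box.lo ≤ d̂⁻_atan,A(l)·S`.
[cite: Yoshida1992HermitianForms, §7 pp. 305–312] -/
theorem devOddABox_lo_le_A (hS : 0 < S) (ha0 : 0 < a) (hC : ConstsValid S a ks C) {F : FDConsts}
    (hF : FDValidA S a A F) {R : IdxRec} {l : ℕ} (hR : MI.mem S (reDigammaQuarter (freq a ((l : ℤ) + 1))) R.reP)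
    {Bo r q p q' Kser : ℕ} (hBo : 0 < Bo) (hr : checkSqrtLower Bo (l + 1) r q = true)
    (hp : checkSqrtUpper 8 Bo p q' = true) {Y : MI} (h : devOddABox S Kser C F R l Bo r q p q' = some Y) :
    (Y.lo : ℝ) ≤ devOddAA a A Bo l * S := by
  have hq : 0 < q := by simp only [checkSqrtLower, Bool.and_eq_true, decide_eq_true_eq] at hr; exact hr.1.1
  have hq' : 0 < q' := by simp only [checkSqrtUpper, Bool.and_eq_true, decide_eq_true_eq] at hp; exact hp.1.1
  unfold devOddABox at h
  split at h
  · rename_i At hAt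
    simp only [Option.some.injEq] at h
    subst h
    set Ca := a * (1 + weilArchDensity (2 * a)) with hCa
    have hCa0 : 0 ≤ Ca := by
      have := weilArchDensity_pos (show 0 < 2 * a by positivity); rw [hCa]; positivity
    set s2 := (Real.exp (a / 2) - Real.exp (-(a / 2))) ^ 2 with hs2
    have hat := MI.mem_arctan hS hC.pi hAt (MI.mem_ofFrac S (r : ℤ) hq)
    have hY : MI.mem S ((reDigammaQuarter (freq a ((l : ℤ) + 1)) - Real.log π) / 2 - 1 / (8 * (l + 1) : ℕ)
        - Ca * (1 / π ^ 2) / ((l + 1) * (l + 1) : ℕ) - (π / 2 - Real.arctan (((r : ℤ) : ℝ) / q)) / 2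
        - Ca * (1 / π ^ 2) * ((p : ℝ) / q') - A / 2 - s2 * a * (1 / π ^ 2) / Bo)
        ((((((((R.reP.sub C.logPi).divNat 2).sub (MI.ofFrac S 1 (8 * (l + 1)))).sub
          ((F.Ca.mul S F.invPi2).divNat ((l + 1) * (l + 1)))).sub (((C.P.divNat 2).sub At).divNat 2)).sub
            ((F.Ca.mul S F.invPi2).mul S (MI.ofFrac S p q'))).sub (F.Aop.divNat 2)).sub
              (((F.s2.mul S C.A).mul S F.invPi2).divNat Bo)) := by
      refine MI.mem_sub (MI.mem_sub (MI.mem_sub (MI.mem_sub (MI.mem_sub (MI.mem_sub ?_ ?_) ?_) ?_) ?_) ?_) ?_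
      · exact mem_of_eq (MI.mem_divNat (MI.mem_sub hR hC.logPi) (n := 2) (by norm_num)) (by norm_num)
      · exact mem_of_eq (MI.mem_ofFrac S 1 (q := 8 * (l + 1)) (by omega)) (by push_cast; ring)
      · exact MI.mem_divNat (MI.mem_mul hS hF.Ca hF.invPi2) (by positivity)
      · have hp2 : MI.mem S (π / 2) (C.P.divNat 2) := mem_of_eq (MI.mem_divNat hC.pi (n := 2) (by norm_num)) (by norm_num)
        exact mem_of_eq (MI.mem_divNat (MI.mem_sub hp2 hat) (n := 2) (by norm_num)) (by norm_num)
      · exact mem_of_eq (MI.mem_mul hS (MI.mem_mul hS hF.Ca hF.invPi2) (MI.mem_ofFrac S p hq')) (by push_cast; ring)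
      · exact mem_of_eq (MI.mem_divNat hF.Aop (n := 2) (by norm_num)) (by norm_num)
      · exact mem_of_eq (MI.mem_divNat (MI.mem_mul hS (MI.mem_mul hS hF.s2 hC.ha) hF.invPi2) hBo) (by ring)
    have hle : (reDigammaQuarter (freq a ((l : ℤ) + 1)) - Real.log π) / 2 - 1 / (8 * (l + 1) : ℕ)
        - Ca * (1 / π ^ 2) / ((l + 1) * (l + 1) : ℕ) - (π / 2 - Real.arctan (((r : ℤ) : ℝ) / q)) / 2
        - Ca * (1 / π ^ 2) * ((p : ℝ) / q') - A / 2 - s2 * a * (1 / π ^ 2) / Bo ≤ devOddAA a A Bo l := by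
      unfold devOddAA
      have hsu := sqrt_le_of_check hp
      have hsl := le_sqrt_of_check hr
      have h1 : Ca * (1 / π ^ 2) * Real.sqrt (8 / (Bo : ℝ)) ≤ Ca * (1 / π ^ 2) * ((p : ℝ) / q') :=
        mul_le_mul_of_nonneg_left (by exact_mod_cast hsu) (by positivity)
      have h2 : Real.arctan (((r : ℤ) : ℝ) / q) ≤ Real.arctan (Real.sqrt Bo / Real.sqrt ((l : ℝ) + 1)) := by
        refine Real.arctan_strictMono.monotone ?_
        rw [← Real.sqrt_div (Nat.cast_nonneg Bo)]
        have : ((r : ℤ) : ℝ) / q = (r : ℝ) / q := by push_cast; ring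
        rw [this]
        have e : Real.sqrt ((Bo : ℝ) / ((l + 1 : ℕ) : ℝ)) = Real.sqrt ((Bo : ℝ) / ((l : ℝ) + 1)) := by push_cast; ring_nf
        exact hsl.trans (le_of_eq e)
      have hl0 : (0 : ℝ) < (l : ℝ) + 1 := by positivity
      have e1 : Ca * (1 / π ^ 2) / (((l + 1) * (l + 1) : ℕ) : ℝ) = a * (1 + weilArchDensity (2 * a)) / (π ^ 2 * ((l : ℝ) + 1) ^ 2) := by
        rw [hCa]; push_cast; field_simp
      have e2 : (1 : ℝ) / ((8 * (l + 1) : ℕ) : ℝ) = 1 / (8 * ((l : ℝ) + 1)) := by push_cast; ring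
      have e3 : Ca * (1 / π ^ 2) * Real.sqrt (8 / (Bo : ℝ)) = a * (1 + weilArchDensity (2 * a)) / π ^ 2 * Real.sqrt (8 / Bo) := by
        rw [hCa]; ring
      have e4 : s2 * a * (1 / π ^ 2) / Bo = (Real.exp (a / 2) - Real.exp (-(a / 2))) ^ 2 * a / (π ^ 2 * Bo) := by
        rw [hs2]; field_simp
      rw [e1, e2, e4]; linarith [h1, h2, e3]
    have hSr : (0 : ℝ) < S := by exact_mod_cast hS
    exact hY.1.trans (by nlinarith)
  · simp at h

/-- **Soundness of `checkWeightsOdd` under `FDValidA`** = the parametrised front door's `hwo` for the weight function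
`woF ws cd Bo`: `0 < w(l) ≤ d̂⁻_atan,A(l)`. [cite: Yoshida1992HermitianForms, §7 pp. 305–312] -/
theorem weights_of_checkOdd_A (hS : 0 < S) (ha0 : 0 < a) (hC : ConstsValid S a ks C) {F : FDConsts}
    (hF : FDValidA S a A F) {Bo K cd Kser q p q' : ℕ} (hBo : 0 < Bo) (hp : checkSqrtUpper 8 Bo p q' = true)
    {ws rs : List ℕ} {N : ℕ} (hCT : TabColValid S a ks Bo N ctab) (hKN : Bo + K + 1 ≤ N)
    (h : checkWeightsOdd S Kser C F ctab Bo K cd ws rs q p q' = true) (l : ℕ) (hl : Bo ≤ l) (hlK : l < Bo + K) :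
    0 < woF ws cd Bo l ∧ woF ws cd Bo l ≤ devOddAA a A Bo l := by
  simp only [checkWeightsOdd, List.all_eq_true, List.mem_range, Bool.and_eq_true, decide_eq_true_eq] at h
  obtain ⟨⟨hpos, hsq⟩, hbox⟩ := h (l - Bo) (by omega)
  have el : Bo + (l - Bo) = l := by omega
  rw [el] at hsq hbox
  split at hbox
  · rename_i Y hY
    simp only [decide_eq_true_eq] at hbox
    have hre : MI.mem S (reDigammaQuarter (freq a ((l : ℤ) + 1))) (tget ctab (l + 1)).reP := by
      have h := (hCT (l + 1) (by omega) (by omega)).2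
      push_cast at h; exact h
    have hlo := devOddABox_lo_le_A hS ha0 hC hF hre hBo hsq hp hY
    refine ⟨?_, ?_⟩
    · simp only [woF]; have : (0 : ℝ) < ws.getD (l - Bo) 0 := by exact_mod_cast hpos
      positivity
    · simp only [woF]
      have := weights_of_checkOdd.dyadic_le_of_lo' hS hbox hlo
      exact_mod_cast this
  · simp at hbox

end Encl

end Literature.NumberTheory.LFunctions.Yoshida1992
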